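/-
Copyright: the b2b-balaban T⁴-continuum CRUX team, row NE7b owner lineage `t4-ne7b-p1` (gen 112). Project licence.
-/
import Summits.QuantumFields.BalabanUV.T4Continuum.Spine.NE7b.OneShotChartFibreChain

/-!
# THE ONE-SHOT CHART AT BLOCK SIDE `M = 2`: `‖H_2‖²_η ≤ ((√2+1)∕2)^d` (`< 2.13` at d = 4, below the consumer threshold `M² = 4`) —
# the near-central alias PAIR: `X_2(p′) ≥ Π_μ (cos²x_μ + sin⁴x_μ∕cos²x_μ) ≥ (2√2 − 2)^d` (`x_μ = p′_μ∕4`), fed to the parametric chain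
# (row NE7b, node U5c; closes the level `M = 2` (`L = 2`, `k = 1`) of NC-NE7b-β (β0) BY PROOF; Literature B4∕B5∕B6 + Mathlib + (39)–(43); [folklore])

Cell `pub-balaban`, sub-cell `t4`, spine estimate NE7b (`T4WeightBudget.RelWeightBound`; the cell's OWN estimate — NOT PRINTED in
[Bałaban 1983–89], NOT PROVED).  Crux-route work under `Spine/NE7b/` by the row OWNER (`t4-ne7b-p1` gen 112) under FREEZE (0)'s
crux-prover clause (RULING W-ne7bp1-g112-1); NOTHING of Bałaban's is asserted; no `T4Continuum/Support` leaf typed; no `def`; zero `sorry`.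

WHY.  (42) gives `‖H_M‖_η ≤ (π∕2)^d` for every block side `M` — below the consumer threshold `M^{(d−2)∕2}` from `M = 8` on at d = 4,
leaving the levels `M = 2, 4` of `L = 2` to NC-NE7b-β (β0).  The loss in (39)–(42) is the use of the CENTRAL alias only; here (i) since
`R_k ≤ 1`, `Σ_k U_kR_k² ≤ X = Σ_k U_kR_k`, so `Σ_τ‖G_τ‖² ≤ N^d·symbR²∕X` (the fibre ratio is at most `1∕X(p′)`, every alias kept); (ii) at
`M = 2` every alias is near-central: `R_k ≥ Π_μ ρ_μ(k_μ)` (a ratio of sums dominates the product of termwise ratios `≤ 1`), `U_k = Π_μ u(k_μ)`,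
so `X ≥ Π_μ (cos²x + sin⁴x∕cos²x)`, `x = p′_μ∕4`, and `t + (1−t)²∕t − (2√2−2) = (√2t−1)²∕t ≥ 0` (`t = cos²x`).  Hence `‖H_2‖²_η ≤ (2√2−2)^{−d}
= ((√2+1)∕2)^d = 2.12… < 4 = M²` at d = 4: the level `k = 1` of `L = 2` is closed BY PROOF (truth `1.184`, desk instrument no. 5).

WHAT IS PROVED ([folklore]; `p ∈ [−π,π]^d`, `a > 0`):
* §3 block side `2`: `Sxir_two`, `Sxir_two_shift`, `S1r_two`, `uFactorr_two_zero` (`|u(p′)|² = cos²(p′∕4)`), `uFactorr_two_one` (`= sin²(p′∕4)`),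
  `prod_le_sum_div_sum` (product of termwise ratios `≤` ratio of sums), `Rr_two_ge`, `pair_ge` (`2√2 − 2 ≤ cos²x + sin⁴x∕cos²x`, `|x| ≤ π∕4`),
  **`Xr_two_ge`** (`(2√2−2)^d ≤ X_2(p)`), **`sum_normSq_G_two_le`** (`Σ_τ ‖G_{2,a,0,τ}(p)‖² ≤ 2^d ((√2+1)∕2)^d symbR(p)²`).
* §4 **`tsum_HBZd_sq_le_sideTwo`**: `(2^d)⁻¹ Σ′_z (H B)(z)² ≤ ((√2+1)∕2)^d Σ′_y B(y)²` at block side `2` (`n = 1`), every `a > 0`, every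
  square-summable `B`; `sqrt_two_add_one_div_two_pow_four_lt` (`((√2+1)∕2)⁴ < 2.13`), **`tsum_HBZd_sq_le_sideTwo_d4`** (`< 2.13·Σ′B²`:
  `‖H_2‖_η < 1.46 < 2 = M^{(d−2)∕2}`).

NOT HERE (honest): the level `M = 4` (the same pair bound needs `inf_x f_4(x) > ½`, a calculus certificate — next), the sharp values
`1.088 ∕ 1.197 ∕ 1.326`; anything of Bałaban's ((A3), NC-NE7b-α UNRULED).  BY-NAME EFFECT ON THE WALL: NONE.  NE7b NOT PRINTED ∕ NOT PROVED;
spine PROVED 0∕9; rung (B)+1 on a FINITE torus — NOT infinite volume, NOT the mass gap, NOT Clay.  HONEST DEPENDENCY: continuum YM on T⁴ ⇐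
BetaPertH ∧ nine spine estimates (0∕9 proved); BetaPertH ⇐ (D1) ∧ (D4) ∧ CAP+tail.
-/

set_option autoImplicit false

namespace Summit.QuantumFields.BalabanUV.T4Continuum.NE7b.OneShotChartSideTwo

open Finset Complex MeasureTheory Filter Topology
open Literature.MathematicalPhysics.QuantumFieldTheory.Balaban1983to89
open B4Strip (ofRealVec Ur uFactorr Er S1r Sxir DeltaXir shiftr Ur_nonneg Sxir_eq S1r_eq uFactorr_nonneg Sxir_nonneg)
open B4StripSums (G)
open B4ContourShift (BZ latticeKernel)
open B6QGQLower276 (X B blk chart)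
open B5Hk165L2Zd (HBZd)
open B6QGQFourier275Zd (symbR Rr Xr Rr_nonneg Xr_ge)
open OneShotChartFibreChain (sum_normSq_G_le_div_Xr tsum_HBZd_sq_le_of_fibre)
open scoped Real

noncomputable section

variable {d : ℕ}

/-! ## §3. Block side `2`: the near-central pair -/

/-- `S_ξ(p) = 16 sin²(p∕4)` at `N = 2`. [folklore] -/
theorem Sxir_two (p : ℝ) : Sxir 2 p = 16 * Real.sin (p / 4) ^ 2 := by
  rw [Sxir_eq]
  have h : p / (2 * ((2 : ℕ) : ℝ)) = p / 4 := by push_cast; ring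
  rw [h]
  push_cast
  ring

/-- `S_ξ(p + 2π) = 16 cos²(p∕4)` at `N = 2` (the mirrored alias). [folklore] -/
theorem Sxir_two_shift (p : ℝ) : Sxir 2 (p + 2 * π) = 16 * Real.cos (p / 4) ^ 2 := by
  rw [Sxir_two]
  have h : (p + 2 * π) / 4 = p / 4 + π / 2 := by ring
  rw [h, Real.sin_add_pi_div_two]

/-- `S₁(p) = 16 sin²(p∕4)cos²(p∕4)`. [folklore] -/
theorem S1r_two (p : ℝ) : S1r p = 16 * Real.sin (p / 4) ^ 2 * Real.cos (p / 4) ^ 2 := by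
  rw [S1r_eq]
  have h : p / 2 = 2 * (p / 4) := by ring
  rw [h, Real.sin_two_mul]
  ring

/-- `sin(p∕4) ≠ 0` for `0 < |p| ≤ π`. [folklore] -/
theorem sin_quarter_ne_zero {p : ℝ} (hp : |p| ≤ π) (h0 : p ≠ 0) : Real.sin (p / 4) ≠ 0 := by
  have hπ := Real.pi_pos
  have h1 : -π < p / 4 := by have := (abs_le.mp hp).1; linarith
  have h2 : p / 4 < π := by have := (abs_le.mp hp).2; linarith
  intro h
  have := (Real.sin_eq_zero_iff_of_lt_of_lt h1 h2).mp h
  exact h0 (by linarith)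

/-- `cos(p∕4) > 0` for `|p| ≤ π`. [folklore] -/
theorem cos_quarter_pos {p : ℝ} (hp : |p| ≤ π) : 0 < Real.cos (p / 4) := by
  have hπ := Real.pi_pos
  refine Real.cos_pos_of_mem_Ioo ⟨?_, ?_⟩
  · have := (abs_le.mp hp).1; linarith
  · have := (abs_le.mp hp).2; linarith

/-- **`|u(p′)|² = cos²(p′∕4)` at `N = 2`** (central alias; the removable value `1` at `p′ = 0` agrees). [folklore] -/
theorem uFactorr_two_zero (p : ℝ) (hp : |p| ≤ π) : uFactorr 2 0 p = Real.cos (p / 4) ^ 2 := by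
  unfold uFactorr
  simp only [if_true]
  by_cases h0 : p = 0
  · rw [if_pos h0, h0]; simp
  · rw [if_neg h0, S1r_two, Sxir_two]
    have hs : Real.sin (p / 4) ≠ 0 := sin_quarter_ne_zero hp h0
    field_simp

/-- **`|u(p′+2π)|² = sin²(p′∕4)` at `N = 2`** (the mirrored alias). [folklore] -/
theorem uFactorr_two_one (p : ℝ) (hp : |p| ≤ π) : uFactorr 2 1 p = Real.sin (p / 4) ^ 2 := by
  unfold uFactorr
  simp only [one_ne_zero, if_false, Nat.cast_one, mul_one]
  rw [S1r_two, Sxir_two_shift]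
  have hc : Real.cos (p / 4) ≠ 0 := (cos_quarter_pos hp).ne'
  field_simp

/-- **product of termwise ratios `≤` ratio of sums**: if `0 ≤ r_i ≤ 1`, `r_i b_i ≤ a_i`, `0 ≤ a_i`, `0 ≤ b_i` and `Σ b > 0` then
`Π_i r_i ≤ (Σ_i a_i)∕(Σ_i b_i)` (each `a_i ≥ (Π r) b_i`). [folklore] -/
theorem prod_le_sum_div_sum {ι : Type*} [Fintype ι] [DecidableEq ι] (a b r : ι → ℝ) (hr0 : ∀ i, 0 ≤ r i) (hr1 : ∀ i, r i ≤ 1)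
    (hrab : ∀ i, r i * b i ≤ a i) (hb : ∀ i, 0 ≤ b i) (hB : 0 < ∑ i, b i) :
    ∏ i, r i ≤ (∑ i, a i) / (∑ i, b i) := by
  have hPle : ∀ i, ∏ j, r j ≤ r i := fun i => by
    rw [← Finset.mul_prod_erase Finset.univ r (Finset.mem_univ i)]
    exact mul_le_of_le_one_right (hr0 i)
      (Finset.prod_le_one (fun j _ => hr0 j) fun j _ => hr1 j)
  rw [le_div_iff₀ hB, Finset.mul_sum]
  exact Finset.sum_le_sum fun i _ =>
    (mul_le_mul_of_nonneg_right (hPle i) (hb i)).trans (hrab i)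

/-- **`R_k ≥ Π_μ ρ_μ(k_μ)` at `N = 2`** with `ρ(0) = 1`, `ρ(1) = sin²(p∕4)∕cos²(p∕4) = S_ξ(p)∕S_ξ(p+2π)`. [folklore] -/
theorem Rr_two_ge (k : Fin d → Fin 2) (s : Fin d → ℝ) (hs : s ∈ BZ d) :
    ∏ μ, (if k μ = 0 then (1 : ℝ) else Real.sin (s μ / 4) ^ 2 / Real.cos (s μ / 4) ^ 2) ≤ Rr 2 k s := by
  classical
  have fin_two_eq : ∀ i : Fin 2, i = 0 ∨ i = 1 := by decide
  have hsμ : ∀ μ, |s μ| ≤ π := fun μ => abs_le.mpr ⟨hs.1 μ, hs.2 μ⟩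
  by_cases hk : k = fun _ => (0 : Fin 2)
  · subst hk
    simp [Rr]
  · unfold Rr
    rw [if_neg hk]
    unfold DeltaXir
    rw [add_zero, add_zero]
    obtain ⟨ν, hν⟩ := Function.ne_iff.mp hk
    have hν1 : k ν = 1 := by
      rcases fin_two_eq (k ν) with h | h
      · exact absurd h hν
      · exact h
    refine prod_le_sum_div_sum (fun μ => Sxir 2 (s μ)) (fun μ => Sxir 2 (shiftr 2 k s μ)) _
      (fun μ => ?_) (fun μ => ?_) (fun μ => ?_) (fun μ => Sxir_nonneg 2 _) ?_
    · split_ifs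
      · exact zero_le_one
      · positivity
    · split_ifs with h
      · exact le_rfl
      · rw [div_le_one (pow_pos (cos_quarter_pos (hsμ μ)) 2)]
        have hc := cos_quarter_pos (hsμ μ)
        have h1 : -(π / 4) ≤ s μ / 4 := by have := (abs_le.mp (hsμ μ)).1; linarith
        have h2 : s μ / 4 ≤ π / 4 := by have := (abs_le.mp (hsμ μ)).2; linarith
        have hcos : Real.cos (π / 4) ≤ Real.cos (s μ / 4) := by
          rw [← Real.cos_abs (s μ / 4)]
          exact Real.cos_le_cos_of_nonneg_of_le_pi (abs_nonneg _) (by linarith [Real.pi_pos])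
            (abs_le.mpr ⟨h1, h2⟩)
        rw [Real.cos_pi_div_four] at hcos
        have hsq : Real.sin (s μ / 4) ^ 2 + Real.cos (s μ / 4) ^ 2 = 1 := Real.sin_sq_add_cos_sq _
        have h22 : Real.sqrt 2 ^ 2 = 2 := Real.sq_sqrt (by norm_num)
        nlinarith [Real.sqrt_nonneg 2]
    · simp only [shiftr]
      rcases fin_two_eq (k μ) with h | h
      · rw [if_pos h, h]; simp
      · rw [if_neg (by rw [h]; exact one_ne_zero), h, Fin.val_one, Nat.cast_one, mul_one, Sxir_two_shift, Sxir_two]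
        have hc := cos_quarter_pos (hsμ μ)
        field_simp
        exact le_rfl
    · refine Finset.sum_pos' (fun μ _ => Sxir_nonneg 2 _) ⟨ν, Finset.mem_univ ν, ?_⟩
      simp only [shiftr]
      rw [hν1, Fin.val_one, Nat.cast_one, mul_one, Sxir_two_shift]
      exact mul_pos (by norm_num) (pow_pos (cos_quarter_pos (hsμ ν)) 2)

/-- **the pair letter**: `2√2 − 2 ≤ cos²x + sin⁴x∕cos²x` for `|x| ≤ π∕4` (`t + (1−t)²∕t − (2√2−2) = (√2t − 1)²∕t`, `t = cos²x ≥ ½`). [folklore] -/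
theorem pair_ge (x : ℝ) (hx : |x| ≤ π / 4) :
    2 * Real.sqrt 2 - 2 ≤ Real.cos x ^ 2 + Real.sin x ^ 4 / Real.cos x ^ 2 := by
  have hπ := Real.pi_pos
  have hc : 0 < Real.cos x := Real.cos_pos_of_mem_Ioo ⟨by have := (abs_le.mp hx).1; linarith,
    by have := (abs_le.mp hx).2; linarith⟩
  set t : ℝ := Real.cos x ^ 2 with ht
  have ht0 : 0 < t := by positivity
  have hs : Real.sin x ^ 4 = (1 - t) ^ 2 := by
    have := Real.sin_sq_add_cos_sq x
    have e : Real.sin x ^ 2 = 1 - t := by rw [ht]; linarith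
    calc Real.sin x ^ 4 = (Real.sin x ^ 2) ^ 2 := by ring
      _ = (1 - t) ^ 2 := by rw [e]
  rw [hs, add_div' _ _ _ ht0.ne', le_div_iff₀ ht0]
  have h22 : Real.sqrt 2 ^ 2 * t ^ 2 = 2 * t ^ 2 := by rw [Real.sq_sqrt (by norm_num)]
  nlinarith [sq_nonneg (Real.sqrt 2 * t - 1), Real.sqrt_nonneg 2]

/-- `2√2 − 2 ≥ 0`. [folklore] -/
theorem two_sqrt_two_sub_two_nonneg : 0 ≤ 2 * Real.sqrt 2 - 2 := by
  have h : (1 : ℝ) ≤ Real.sqrt 2 := by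
    rw [show (1 : ℝ) = Real.sqrt 1 by simp]
    exact Real.sqrt_le_sqrt (by norm_num)
  linarith

/-- **`X_2(p) ≥ (2√2 − 2)^d` on the zone**: every alias of block side `2` is kept; `U_k = Π_μ u(k_μ)`, `R_k ≥ Π_μ ρ(k_μ)`, the sum over
`k ∈ {0,1}^d` of the products is the product of the coordinate pair sums `cos² + sin⁴∕cos² ≥ 2√2 − 2`. [folklore] -/
theorem Xr_two_ge (s : Fin d → ℝ) (hs : s ∈ BZ d) : (2 * Real.sqrt 2 - 2) ^ d ≤ Xr 2 s := by
  classical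
  have hsμ : ∀ μ, |s μ| ≤ π := fun μ => abs_le.mpr ⟨hs.1 μ, hs.2 μ⟩
  -- the coordinate letters `u(j)ρ(j)`
  set f : Fin d → Fin 2 → ℝ := fun μ j =>
    uFactorr 2 (j : ℕ) (s μ) * (if j = 0 then (1 : ℝ) else Real.sin (s μ / 4) ^ 2 / Real.cos (s μ / 4) ^ 2) with hf
  have hpair : ∀ μ, ∑ j : Fin 2, f μ j = Real.cos (s μ / 4) ^ 2 + Real.sin (s μ / 4) ^ 4 / Real.cos (s μ / 4) ^ 2 := by
    intro μ
    rw [Fin.sum_univ_two]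
    simp only [hf, Fin.val_zero, Fin.val_one, if_true, one_ne_zero, if_false]
    rw [uFactorr_two_zero _ (hsμ μ), uFactorr_two_one _ (hsμ μ)]
    ring
  calc (2 * Real.sqrt 2 - 2) ^ d = ∏ _μ : Fin d, (2 * Real.sqrt 2 - 2) := by
        rw [Finset.prod_const, Finset.card_univ, Fintype.card_fin]
    _ ≤ ∏ μ, ∑ j : Fin 2, f μ j := by
        refine Finset.prod_le_prod (fun _ _ => two_sqrt_two_sub_two_nonneg) fun μ _ => ?_
        rw [hpair]
        refine pair_ge (s μ / 4) ?_
        rw [abs_div, abs_of_pos (by norm_num : (0:ℝ) < 4)]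
        have := hsμ μ
        linarith
    _ = ∑ k : Fin d → Fin 2, ∏ μ, f μ (k μ) := by
        rw [Finset.prod_univ_sum, Fintype.piFinset_univ]
    _ ≤ Xr 2 s := by
        unfold Xr
        refine Finset.sum_le_sum fun k _ => ?_
        have hU : Ur 2 k s = ∏ μ, uFactorr 2 (k μ : ℕ) (s μ) := rfl
        rw [show (∏ μ, f μ (k μ)) = (∏ μ, uFactorr 2 (k μ : ℕ) (s μ))
            * ∏ μ, (if k μ = 0 then (1 : ℝ) else Real.sin (s μ / 4) ^ 2 / Real.cos (s μ / 4) ^ 2) by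
          rw [← Finset.prod_mul_distrib], ← hU]
        exact mul_le_mul_of_nonneg_left (Rr_two_ge k s hs) (Ur_nonneg 2 k s)

/-- `(2√2 − 2)·((√2 + 1)∕2) = 1`. [folklore] -/
theorem two_sqrt_two_sub_two_mul : (2 * Real.sqrt 2 - 2) * ((Real.sqrt 2 + 1) / 2) = 1 := by
  have h22 : Real.sqrt 2 ^ 2 = 2 := Real.sq_sqrt (by norm_num)
  nlinarith

/-- **THE FIBRE BOUND AT BLOCK SIDE `2`**: `Σ_τ ‖G_{2,a,0,τ}(p)‖² ≤ 2^d·((√2+1)∕2)^d·symbR(p)²` on the zone. [folklore] -/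
theorem sum_normSq_G_two_le {a : ℝ} (ha : 0 < a) (p : Fin d → ℝ) (hp : p ∈ BZ d) :
    ∑ τ : Fin d → Fin 2, ‖G 2 a 0 τ (ofRealVec p)‖ ^ 2 ≤ (2 : ℝ) ^ d * ((Real.sqrt 2 + 1) / 2) ^ d * symbR 2 a p ^ 2 := by
  have hc0 : 0 < 2 * Real.sqrt 2 - 2 := by
    have h : (1 : ℝ) < Real.sqrt 2 := by
      rw [show (1 : ℝ) = Real.sqrt 1 by simp]
      exact Real.sqrt_lt_sqrt (by norm_num) (by norm_num)
    linarith
  have hX := Xr_two_ge p hp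
  have hXpos : 0 < Xr 2 p := lt_of_lt_of_le (pow_pos hc0 d) hX
  have h1 := sum_normSq_G_le_div_Xr (d := d) 2 (by norm_num) ha p hp
  have hinv : ((Real.sqrt 2 + 1) / 2) ^ d = ((2 * Real.sqrt 2 - 2) ^ d)⁻¹ := by
    rw [← inv_pow]
    congr 1
    exact eq_inv_of_mul_eq_one_right two_sqrt_two_sub_two_mul
  calc ∑ τ : Fin d → Fin 2, ‖G 2 a 0 τ (ofRealVec p)‖ ^ 2 ≤ ((2 : ℕ) : ℝ) ^ d * (symbR 2 a p ^ 2 / Xr 2 p) := h1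
    _ ≤ (2 : ℝ) ^ d * (symbR 2 a p ^ 2 / (2 * Real.sqrt 2 - 2) ^ d) := by
        push_cast
        refine mul_le_mul_of_nonneg_left ?_ (by positivity)
        exact div_le_div_of_nonneg_left (sq_nonneg _) (pow_pos hc0 d) hX
    _ = (2 : ℝ) ^ d * ((Real.sqrt 2 + 1) / 2) ^ d * symbR 2 a p ^ 2 := by
        rw [hinv, div_eq_mul_inv]; ring

/-! ## §4. The headline at block side `2` -/

/-- **`‖H_2‖²_{ℓ² → ℓ²_η} ≤ ((√2+1)∕2)^d`**: at block side `2` (`n = 1`), for every `a > 0` and every square-summable coarse field `B`,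
`(2^d)⁻¹ Σ′_z (H B)(z)² ≤ ((√2+1)∕2)^d Σ′_y B(y)²`. [folklore] -/
theorem tsum_HBZd_sq_le_sideTwo {a : ℝ} (ha : 0 < a) (Bf : X d → ℝ) (hB : Summable fun x => Bf x ^ 2) :
    ((2 : ℝ) ^ d)⁻¹ * ∑' z : X d, HBZd 1 a Bf z ^ 2 ≤ ((Real.sqrt 2 + 1) / 2) ^ d * ∑' y : X d, Bf y ^ 2 := by
  have hK0 : 0 ≤ ((Real.sqrt 2 + 1) / 2) ^ d := by positivity
  have hK : ∀ p ∈ BZ d, ∑ τ : Fin d → Fin (1 + 1), ‖G (1 + 1) a 0 τ (ofRealVec p)‖ ^ 2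
      ≤ (((1 : ℕ) : ℝ) + 1) ^ d * ((Real.sqrt 2 + 1) / 2) ^ d * symbR (1 + 1) a p ^ 2 := by
    intro p hp
    have h := sum_normSq_G_two_le ha p hp
    norm_num
    exact h
  have h := tsum_HBZd_sq_le_of_fibre 1 ha hK0 hK Bf hB
  have h2 : (((1 : ℕ) : ℝ) + 1) ^ d = (2 : ℝ) ^ d := by norm_num
  rw [h2] at h
  have hN : (0 : ℝ) < (2 : ℝ) ^ d := by positivity
  rw [inv_mul_le_iff₀ hN, ← mul_assoc]
  exact h

/-- `((√2 + 1)∕2)⁴ < 2.13` (`√2 < 1.4143`). [folklore] -/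
theorem sqrt_two_add_one_div_two_pow_four_lt : ((Real.sqrt 2 + 1) / 2) ^ 4 < 2.13 := by
  have h : Real.sqrt 2 < 1.4143 := by
    rw [Real.sqrt_lt' (by norm_num)]; norm_num
  have h0 : 0 ≤ (Real.sqrt 2 + 1) / 2 := by positivity
  have h1 : (Real.sqrt 2 + 1) / 2 < 1.20715 := by linarith
  calc ((Real.sqrt 2 + 1) / 2) ^ 4 < (1.20715 : ℝ) ^ 4 := pow_lt_pow_left₀ h1 h0 (by norm_num)
    _ < 2.13 := by norm_num

/-- **d = 4, block side 2**: `(2⁴)⁻¹ Σ′_z (H B)(z)² ≤ 2.13·Σ′_y B(y)²`, i.e. `‖H_2‖_η < 1.46 < 2 = M^{(d−2)∕2}` — the level `k = 1` of `L = 2`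
is below the consumer threshold BY PROOF (truth `1.088`; NC-NE7b-β (β0)'s first half discharged without numerics). [folklore] -/
theorem tsum_HBZd_sq_le_sideTwo_d4 {a : ℝ} (ha : 0 < a) (Bf : X 4 → ℝ) (hB : Summable fun x => Bf x ^ 2) :
    ((2 : ℝ) ^ 4)⁻¹ * ∑' z : X 4, HBZd 1 a Bf z ^ 2 ≤ 2.13 * ∑' y : X 4, Bf y ^ 2 := by
  have h := tsum_HBZd_sq_le_sideTwo (d := 4) ha Bf hB
  have h0 : 0 ≤ ∑' y : X 4, Bf y ^ 2 := tsum_nonneg fun y => sq_nonneg _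
  have hc := sqrt_two_add_one_div_two_pow_four_lt
  nlinarith

end

end Summit.QuantumFields.BalabanUV.T4Continuum.NE7b.OneShotChartSideTwo
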